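import Literature.Computability.AlgebraicComplexity.Kron444HullCheck
import HarnessLib

/-!
# `Kron(4,4,4) ⊆ conv(328 vertices)`: certificate checks, part 10/14

Proofs file (computations only): the node checks of `Kron444HullCheck.lean` for the chunks
129 … 142 of the certificate, each decided by the kernel (`decide +kernel`; `maxHeartbeats 0`:
a chunk is ≈ 10⁵–10⁶ kernel reductions). Assembled in `Kron444Hull.lean`. [folklore]
-/

set_option Elab.async false

namespace Literature.Computability.AlgebraicComplexity.Kron444Hull

/-- Nodes `3225 … 3249` of the certificate (chunk `129`) pass `checkNodeRec`. [folklore] -/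
theorem checkChunk_129 : checkChunk 129 25 = true := by
  set_option maxHeartbeats 0 in decide +kernel

/-- Nodes `3250 … 3274` of the certificate (chunk `130`) pass `checkNodeRec`. [folklore] -/
theorem checkChunk_130 : checkChunk 130 25 = true := by
  set_option maxHeartbeats 0 in decide +kernel

/-- Nodes `3275 … 3299` of the certificate (chunk `131`) pass `checkNodeRec`. [folklore] -/
theorem checkChunk_131 : checkChunk 131 25 = true := by
  set_option maxHeartbeats 0 in decide +kernel

/-- Nodes `3300 … 3324` of the certificate (chunk `132`) pass `checkNodeRec`. [folklore] -/
theorem checkChunk_132 : checkChunk 132 25 = true := by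
  set_option maxHeartbeats 0 in decide +kernel

/-- Nodes `3325 … 3349` of the certificate (chunk `133`) pass `checkNodeRec`. [folklore] -/
theorem checkChunk_133 : checkChunk 133 25 = true := by
  set_option maxHeartbeats 0 in decide +kernel

/-- Nodes `3350 … 3374` of the certificate (chunk `134`) pass `checkNodeRec`. [folklore] -/
theorem checkChunk_134 : checkChunk 134 25 = true := by
  set_option maxHeartbeats 0 in decide +kernel

/-- Nodes `3375 … 3399` of the certificate (chunk `135`) pass `checkNodeRec`. [folklore] -/
theorem checkChunk_135 : checkChunk 135 25 = true := by
  set_option maxHeartbeats 0 in decide +kernel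

/-- Nodes `3400 … 3424` of the certificate (chunk `136`) pass `checkNodeRec`. [folklore] -/
theorem checkChunk_136 : checkChunk 136 25 = true := by
  set_option maxHeartbeats 0 in decide +kernel

/-- Nodes `3425 … 3449` of the certificate (chunk `137`) pass `checkNodeRec`. [folklore] -/
theorem checkChunk_137 : checkChunk 137 25 = true := by
  set_option maxHeartbeats 0 in decide +kernel

/-- Nodes `3450 … 3474` of the certificate (chunk `138`) pass `checkNodeRec`. [folklore] -/
theorem checkChunk_138 : checkChunk 138 25 = true := by
  set_option maxHeartbeats 0 in decide +kernel

/-- Nodes `3475 … 3499` of the certificate (chunk `139`) pass `checkNodeRec`. [folklore] -/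
theorem checkChunk_139 : checkChunk 139 25 = true := by
  set_option maxHeartbeats 0 in decide +kernel

/-- Nodes `3500 … 3524` of the certificate (chunk `140`) pass `checkNodeRec`. [folklore] -/
theorem checkChunk_140 : checkChunk 140 25 = true := by
  set_option maxHeartbeats 0 in decide +kernel

/-- Nodes `3525 … 3549` of the certificate (chunk `141`) pass `checkNodeRec`. [folklore] -/
theorem checkChunk_141 : checkChunk 141 25 = true := by
  set_option maxHeartbeats 0 in decide +kernel

/-- Nodes `3550 … 3574` of the certificate (chunk `142`) pass `checkNodeRec`. [folklore] -/
theorem checkChunk_142 : checkChunk 142 25 = true := by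
  set_option maxHeartbeats 0 in decide +kernel

end Literature.Computability.AlgebraicComplexity.Kron444Hull
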